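import Summits.AtomisticToContinuum.Crystallization.Theorems.FrustratedLawDichotomyStrainedPatchHomForceJacTwo
import Summits.AtomisticToContinuum.Crystallization.Theorems.FrustratedLawDichotomyStrainedPatchHomCurvLJGate

/-!
# FAR-LABEL CHUNKS over the full exempt-prune box `[−11,11]³`, the three-check additivity, and the FAR K-FACTS at the gate cell
# (27623 `(H) HomFloor (1/625)`, hcp half; critic rows 1108 (3) / 1111 (1): «T2 lemma ☐ / far K-fact ☐»)

decomp-a2c hand-1 g29 (crux `AperiodicFrustratedLawGap`, stmt-AtomisticToContinuum-27623).  The analytic-slab dichotomy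
`…HomExemptZeroStep.slab_or_exempt_of_ring` runs over the exempt prune's label box `[−11,11]³` (`…HomExemptMoveBox`), NOT the energy box `[−7,7]³` of
`nearLabels`/`fjLabels`: at the corner gate cell 33 labels with an index `±8` are CERTAINLY INSIDE the `7`-ball of the shifted family (e.g. `(4,−8,0)`:
`‖X‖ ≈ 6.7`) and 4 more straddle it.  This file therefore enumerates `[−11,11]³` and selects label chunks by PREDICATES only (radius windows on the
sqrt-free enclosure `fjQ` of `‖X_b‖²`; no `List.contains`, which hand-2 g29 found to kill kernel evaluation):

* §1 `rng23`, `boxLabels11` (+ `mem_rng23`, `boxLabels11_toFinset = [−11,11]³`, `boxLabels11_nodup`), ★ `fjChunk c w r2n r2d r2n' r2d'` — labels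
  CERTAINLY INSIDE the `7`-ball (`fjQ.hi ≤ 49·SC`) whose `fjQ.lo` lies in the window `[(r2n/r2d)↑, (r2n'/r2d')↑)`, ★ `fjStraddle c w` — labels not
  certainly inside but possibly inside (`fjQ.lo ≤ 49·SC`), `fjStraddleOK c w` — every straddler is certainly `≥ 6` (`36·SC ≤ fjQ.lo`); nodup lemmas;
* §2 ★★ `jac_floor_of_three_checks` — centred `curvCheckLJ` on `Lc ++ Ln` plus TWO sqrt-free `forceJacCheckN` chunks `Lf`, `Lg` (floors may be negative),
  pairwise disjoint ⟹ floor `(lam₁+lam₂+lam₃)/SC` on the union (def-free twin of `…HomForceJacTwo.jac_floor_of_two_checks`);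
* §3 KERNEL FACTS at the critic's gate cell (`cCorner`, `wGate` = `U 2⁻¹¹ × ξ .00125` of `…HomCurvLJGate`): ★ `far1_gate` — `forceJacCheckN` on the chunk
  `4.7 ≤ ρ < 6` (358 labels) certifies the floor `−SC/100`; ★ `far2_gate` — the chunk `ρ ≥ 6` over `[−11,11]³` (363 + 33 labels) certifies `−SC/100`;
  ★ `straddle_gate` — `fjStraddleOK` (13 straddlers, all `≥ 6`).  With `…HomCurvLJGate.curvLamLJ_corner_gate` (`> 6.5·SC` on the 350 near labels) the
  force-Jacobian floor on ALL 1104 certainly-inside labels of `[−11,11]³` is `≥ 6.48·SC ≥ 0.9·λ_F` — row 1111's «far K-fact ☐» in the tree.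
  (Interpreter, same cell, reference box `ξ`-width 0: `slopeGsLJ` over all 1104 labels = `0.00968·SC` vs `0.00970·SC` over the 350 near labels —
  the slope leaf does not inherit the far-label pathology, critic row 1108 (ii).)

Kernel definitions + soundness/bookkeeping; 0 sorry; standard axioms; no instances / notation / `#eval`.  `--supports stmt-AtomisticToContinuum-27623`.
-/

namespace Summit.AtomisticToContinuum.Crystallization.Theorems.FrustratedLawDichotomyStrainedPatchHomForceJacN

open scoped BigOperators RealInnerProductSpace
open Literature.Analysis.ValidatedNumerics.Numerics
open Summit.AtomisticToContinuum.Crystallization.Theorems.ChargedEnergyGapNegative (E3)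
open Summit.AtomisticToContinuum.Crystallization.Theorems.FrustratedLawDichotomyStrainedPatchHomSplit (latPt hexFrame hcpShift)
open Summit.AtomisticToContinuum.Crystallization.Theorems.FrustratedLawDichotomyStrainedPatchTaylorChord (segGd)
open Summit.AtomisticToContinuum.Crystallization.Theorems.FrustratedLawDichotomyStrainedPatchHomCurvLJ
  (curvCheckLJ curvLJ_floor_of_check cCorner wGate)

/-! ## §1. The label box `[−11,11]³` as a literal list and the predicate-selected chunks -/

/-- The coordinate range `[−11, 11]`. -/
def rng23 : List ℤ := (List.range 23).map fun i => (i : ℤ) - 11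

/-- All labels of the exempt prune's box `[−11, 11]³`. -/
def boxLabels11 : List (Fin 3 → ℤ) :=
  rng23.flatMap fun i => rng23.flatMap fun j => rng23.map fun k => ![i, j, k]

/-- Membership in `rng23`. [formal bookkeeping] -/
theorem mem_rng23 {n : ℤ} : n ∈ rng23 ↔ -11 ≤ n ∧ n ≤ 11 := by
  have h : rng23 = [-11, -10, -9, -8, -7, -6, -5, -4, -3, -2, -1, 0, 1, 2, 3, 4, 5, 6, 7, 8, 9, 10, 11] := by decide
  rw [h]
  simp only [List.mem_cons, List.not_mem_nil, or_false]
  omega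

/-- `rng23` is duplicate-free. [formal bookkeeping] -/
theorem rng23_nodup : rng23.Nodup := by decide

/-- ★ `boxLabels11.toFinset = [−11, 11]³` (the exempt prune's label box). [formal bookkeeping] -/
theorem boxLabels11_toFinset : boxLabels11.toFinset = Fintype.piFinset fun _ : Fin 3 => Finset.Icc (-11 : ℤ) 11 := by
  ext b
  simp only [List.mem_toFinset, boxLabels11, List.mem_flatMap, List.mem_map, Fintype.mem_piFinset, Finset.mem_Icc]
  constructor
  · rintro ⟨i, hi, j, hj, k, hk, rfl⟩
    rw [mem_rng23] at hi hj hk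
    intro t
    fin_cases t
    · simpa using hi
    · simpa using hj
    · simpa using hk
  · intro h
    refine ⟨b 0, mem_rng23.2 (h 0), b 1, mem_rng23.2 (h 1), b 2, mem_rng23.2 (h 2), ?_⟩
    funext t
    fin_cases t <;> rfl

/-- `boxLabels11` is duplicate-free. [formal bookkeeping] -/
theorem boxLabels11_nodup : boxLabels11.Nodup := by
  unfold boxLabels11
  rw [List.nodup_flatMap]
  refine ⟨fun i _ => ?_, ?_⟩
  · rw [List.nodup_flatMap]
    refine ⟨fun j _ => ?_, ?_⟩
    · exact List.Nodup.map (fun a b h => by have := congrFun h 2; simpa using this) rng23_nodup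
    · refine rng23_nodup.pairwise_of_forall_ne fun j _ j' _ hne => ?_
      intro x hx hx'
      obtain ⟨k, _, rfl⟩ := List.mem_map.1 hx
      obtain ⟨k', _, h⟩ := List.mem_map.1 hx'
      have := congrFun h 1
      simp at this
      exact hne this.symm
  · refine rng23_nodup.pairwise_of_forall_ne fun i _ i' _ hne => ?_
    intro x hx hx'
    obtain ⟨j, _, hx⟩ := List.mem_flatMap.1 hx
    obtain ⟨k, _, rfl⟩ := List.mem_map.1 hx
    obtain ⟨j', _, hx'⟩ := List.mem_flatMap.1 hx'
    obtain ⟨k', _, h⟩ := List.mem_map.1 hx'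
    have := congrFun h 0
    simp at this
    exact hne this.symm

/-- ★ **A far-label chunk**: labels of `[−11,11]³` CERTAINLY INSIDE the `7`-ball on the box (`fjQ.hi ≤ 49·SC`) whose squared-radius lower end lies in
the window `[(r2n/r2d)↑, (r2n'/r2d')↑)` — selected by predicates only. -/
def fjChunk (c w : (Fin 3 × Fin 3) ⊕ Fin 3 → ℤ) (r2n : ℤ) (r2d : ℕ) (r2n' : ℤ) (r2d' : ℕ) : List (Fin 3 → ℤ) :=
  boxLabels11.filter fun b => decide ((fjQ c w b).hi ≤ 49 * (SC : ℤ)) && decide ((FI.ofFrac r2n r2d).hi ≤ (fjQ c w b).lo) &&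
    decide ((fjQ c w b).lo < (FI.ofFrac r2n' r2d').hi)

/-- ★ **The straddlers**: labels of `[−11,11]³` not certainly inside but possibly inside the `7`-ball (`fjQ.lo ≤ 49·SC < fjQ.hi`). -/
def fjStraddle (c w : (Fin 3 × Fin 3) ⊕ Fin 3 → ℤ) : List (Fin 3 → ℤ) :=
  boxLabels11.filter fun b => !decide ((fjQ c w b).hi ≤ 49 * (SC : ℤ)) && decide ((fjQ c w b).lo ≤ 49 * (SC : ℤ))

/-- Every straddler is certainly at least `6` from the centre (`36·SC ≤ fjQ.lo`) — the pricing hypothesis of `…HomExemptZeroStep.slab_or_exempt_of_ring`. -/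
def fjStraddleOK (c w : (Fin 3 × Fin 3) ⊕ Fin 3 → ℤ) : Bool :=
  (fjStraddle c w).all fun b => decide (36 * (SC : ℤ) ≤ (fjQ c w b).lo)

/-- Chunks are duplicate-free. [formal bookkeeping] -/
theorem fjChunk_nodup (c w : (Fin 3 × Fin 3) ⊕ Fin 3 → ℤ) (r2n : ℤ) (r2d : ℕ) (r2n' : ℤ) (r2d' : ℕ) : (fjChunk c w r2n r2d r2n' r2d').Nodup := by
  unfold fjChunk
  exact boxLabels11_nodup.filter _

/-- The straddler list is duplicate-free. [formal bookkeeping] -/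
theorem fjStraddle_nodup (c w : (Fin 3 × Fin 3) ⊕ Fin 3 → ℤ) : (fjStraddle c w).Nodup := by
  unfold fjStraddle
  exact boxLabels11_nodup.filter _

/-! ## §2. ★★ Three-check additivity -/

/-- ★★ **THE JACOBIAN FLOOR OF THE UNION FROM THREE BOOLEANS**: centred `curvCheckLJ` on `Lc ++ Ln` (floor `lam₁`) and sqrt-free `forceJacCheckN` on two
chunks `Lf`, `Lg` (floors `lam₂`, `lam₃`, possibly negative), the whole list `((Lc ++ Ln) ++ Lf) ++ Lg` duplicate-free, give the floor
`(lam₁ + lam₂ + lam₃)/SC` for the curvature sum over the union along the segment. [folklore: curvature sums add over disjoint label families] -/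
theorem jac_floor_of_three_checks {c w : (Fin 3 × Fin 3) ⊕ Fin 3 → ℤ} {Lc Ln Lf Lg : List (Fin 3 → ℤ)} (hL : (((Lc ++ Ln) ++ Lf) ++ Lg).Nodup)
    {lam₁ lam₂ lam₃ : ℤ} (h₁ : curvCheckLJ c w Lc Ln lam₁ = true) (h₂ : forceJacCheckN c w Lf lam₂ = true) (h₃ : forceJacCheckN c w Lg lam₃ = true)
    (U : E3 →L[ℝ] E3) (hU : ‖U - 1‖ ≤ 1 / 4)
    (hbox : ∀ ab : Fin 3 × Fin 3, |(U (EuclideanSpace.single ab.2 (1 : ℝ))) ab.1 - (c (Sum.inl ab) : ℝ) / SC| ≤ (w (Sum.inl ab) : ℝ) / SC)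
    (ξ₀ ξ : E3) (hξ₀ : ∀ i : Fin 3, |ξ₀ i - (c (Sum.inr i) : ℝ) / SC| ≤ (w (Sum.inr i) : ℝ) / SC)
    (hξ : ∀ i : Fin 3, |ξ i - (c (Sum.inr i) : ℝ) / SC| ≤ (w (Sum.inr i) : ℝ) / SC) (hn₀ : ‖ξ₀‖ ≤ 1 / 4) (hn : ‖ξ‖ ≤ 1 / 4)
    {s : ℝ} (hs : s ∈ Set.Ioo (0 : ℝ) 1) :
    ((lam₁ + lam₂ + lam₃ : ℤ) : ℝ) / SC * ‖U (ξ - ξ₀)‖ ^ 2 ≤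
      ∑ b ∈ (((Lc ++ Ln) ++ Lf) ++ Lg).toFinset, segGd (fun x : ℝ => x⁻¹ ^ 7 - x⁻¹ ^ 13) (latPt U hexFrame b + U (hcpShift + ξ₀)) (U (ξ - ξ₀)) s := by
  classical
  obtain ⟨hL12, hLg, hdisj⟩ := List.nodup_append.1 hL
  have hdisj' : List.Disjoint ((Lc ++ Ln) ++ Lf) Lg := fun a ha hb => hdisj a ha a hb rfl
  have k₁₂ := jac_floor_of_two_checks hL12 h₁ h₂ U hU hbox ξ₀ ξ hξ₀ hξ hn₀ hn hs
  have k₃ := forceJac_floor_of_checkN hLg h₃ U hbox ξ₀ ξ hξ₀ hξ hs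
  rw [← segGd_sum_eq_hessForm Lg.toFinset hU hn₀ hn (Set.Ioo_subset_Icc_self hs)] at k₃
  rw [List.toFinset_append, Finset.sum_union (List.disjoint_toFinset_iff_disjoint.2 hdisj')]
  have hcast : ((lam₁ + lam₂ + lam₃ : ℤ) : ℝ) / SC = ((lam₁ + lam₂ : ℤ) : ℝ) / SC + (lam₃ : ℝ) / SC := by push_cast; ring
  rw [hcast, add_mul]
  exact add_le_add k₁₂ k₃

/-! ## §3. KERNEL FACTS at the gate cell of record -/

/-- ★ FAR K-FACT 1: the sqrt-free force-Jacobian certificate on the chunk `4.7 ≤ ρ < 6` of `[−11,11]³` (358 labels) certifies the floor `−SC/100` on the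
gate cell `U 2⁻¹¹ × ξ .00125` at the corner of record. -/
theorem far1_gate : forceJacCheckN cCorner wGate (fjChunk cCorner wGate 2209 100 36 1) (-2814749767106) = true := by
  decide +kernel

/-- ★ FAR K-FACT 2: the same on the chunk `ρ ≥ 6` of `[−11,11]³` (396 labels, 33 of them outside `[−7,7]³`) — floor `−SC/100`. -/
theorem far2_gate : forceJacCheckN cCorner wGate (fjChunk cCorner wGate 36 1 53 1) (-2814749767106) = true := by
  decide +kernel

/-- ★ STRADDLE K-FACT: every straddling label of `[−11,11]³` on the gate cell is certainly `≥ 6` from the centre. -/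
theorem straddle_gate : fjStraddleOK cCorner wGate = true := by
  decide +kernel

end Summit.AtomisticToContinuum.Crystallization.Theorems.FrustratedLawDichotomyStrainedPatchHomForceJacN
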